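import Literature.MathematicalPhysics.QuantumFieldTheory.Balaban1983to89.B8Eq188Proof
import Literature.MathematicalPhysics.QuantumFieldTheory.Balaban1983to89.B7Eq32ExpDifferential
import Literature.MathematicalPhysics.QuantumFieldTheory.Balaban1983to89.B8SectDSource
import Literature.MathematicalPhysics.QuantumLattice.LieTrotter

/-!
# `Balaban1983to89.B8Prop5LocalLipschitz` — T. Bałaban, *Spaces of regular gauge field configurations on a lattice and gauge fixing
# conditions*, Commun. Math. Phys. **99** (1985) 75–102 [Balaban1985RegularSpaces] ("B8"), Sect. D pp. 92–94: THE LOCAL (sitewise)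
# INGREDIENTS OF (1.98), (1.99) AND OF THE CAUCHY STEP (1.104)–(1.106) — the sizes `|V| ≤ O(α₄)` of `V = g(i ad_λ) − 1`, of
# `e^{−i ad_λ} − 1`, and the LIPSCHITZ MODULI in the gauge parameter of `e^{−i ad_λ}`, `g(i ad_λ)`, and of the remainders `𝔉₁`, `𝔉₂` of
# (1.82)–(1.85) (hence of `𝔉₃` of (1.88)–(1.89)), each obtained as print obtains (1.106): by the Cauchy formula for an analytic function
# of ONE algebra-valued variable from a SUP bound on a complex disc

statement-level skeleton of published theorems with citation tags; proofs where landed; nothing here is a claim about the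
Yang–Mills mass gap

PDF held: `paper:balaban1985-cmp99-regular-spaces-gauge-fixing` (journal page = PDF page + 74); pp. 90–94 [PDF 16–20] read on the text
layer by this seat (2026-08-26); [3] = [Balaban1985Averaging] (29)–(41) pp. 22–24 through the tree's `Literature.Analysis.Calculus.ExpDifferential*`,
`B7Eq38Remainder`, `B7Eq32ExpDifferential`, `B8Eq182Proof`.

WHAT IS PRINTED.  p. 92 [PDF 18]: *"Let us denote by V the operator g(…) − 1 in the internal bracket […] in (1.94). It is a very simple
local operator of the form (Vf)(x) = V(x)f(x), where V(x) is a linear operator on the Lie algebra g, satisfying the bound |V| ≤ O(α₄).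
… |Rf|₍₋₂₎ ≤ B′₀|f|₍₋₂₎, |Vf|₍₋₂₎ ≤ O(α₄)|f|₍₋₂₎. (1.98)"*; p. 93 [PDF 19]: *"(1.99) … The function 𝔉 is obviously an analytic function
in λ and we consider configurations λ with values in the complexified algebra."*; p. 94 [PDF 20]: *"let us apply the Cauchy formula for
the derivative of the analytic function in τ above … (1.105) with r = (4max{|λ₁−λ₂|, |Dλ₁−Dλ₂|₍₋₁₎})⁻¹α₄ … and we use the inequality
(1.99). We get |𝔉(λ₁) − 𝔉(λ₂)|, |D(𝔉(λ₁) − 𝔉(λ₂))|₍₋₁₎ ≤ B′₀C′₄B₁(α₀+α₁) 4max{|λ₁−λ₂|, |Dλ₁−Dλ₂|₍₋₁₎}, (1.106)"*; p. 91 [PDF 17]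
(1.89): *"|𝔉₃(λ(x), Dλ, A)| ≤ O(1)|Dλ||A|"*; p. 90 [PDF 16] (1.83)/(1.85): the remainders `𝔉₁ = O(|Dλ|²)`, `𝔉₂ = O(|A||Dλ|)`.

WHY THIS FILE (cell `pub-ymgap`, HUMAN RULING D-0062, dag-lead REBALANCE №41-b; seat `pub-ymgap-dag-n19-b` g2; CUT-3 «hP5 at k levels
from letters» of `pub-ymgap-dag-n05-a`, route step (i) = the (1.100) fixed point by the (1.101)–(1.106) contraction at `k` levels).
The contraction (sibling `B8Prop5ContractionKLevel`, on the space `B8LambdaSpaceKLevel.lamSubK`) is assembled from the letters of [4] and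
from LOCAL facts about the explicit functions of the tree's (1.82)–(1.89) chain (`B8Eq182Proof.gAd/F183/F185/frakF1/frakF2`,
`B8Eq188Proof.frakF3`): their printed SIZES are in the tree (`norm_gAd_le`, `norm_F183_le`, `norm_F185_le`, `norm_frakF1_le`, …); what the
contraction needs in addition — and what this file proves — is (a) the size of `g(i ad_Y)X − X` PROPORTIONAL TO `|Y|` (print's
«|V| ≤ O(α₄)»; the tree's `B8Ineq1109Local.norm_gAd_sub_self_le` has the constant ⅓ instead) and of `e^{−i ad_Y}X − X`, and (b) the
LIPSCHITZ MODULI of these functions in the gauge parameter with the SECOND-ORDER structure of (1.83)/(1.85) preserved — by print's own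
device: analyticity in one complexified variable + the Cauchy formula (r05's kernel form `B8SectDSource.lipschitz_of_norm_le`).

WHAT THIS FILE PROVES (kernel, 0 sorry, theorems only, no `def`; `𝔸` a complete normed `ℂ`-algebra with `‖1‖ = 1`).
* §1 **`norm_conjExp_le`** (`‖e^{−Z}Ye^{Z}‖ ≤ e^{2‖Z‖}‖Y‖`),
  `differentiable_conjExp`, **`norm_conjExp_sub_conjExp_le`** (`‖e^{−Z₁}Ye^{Z₁} − e^{−Z₂}Ye^{Z₂}‖ ≤ 18‖Z₁ − Z₂‖‖Y‖` for `‖Zᵢ‖ ≤ ½`),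
  **`norm_conjExp_sub_self_le`** (`‖e^{−Z}Ye^{Z} − Y‖ ≤ 18‖Z‖‖Y‖`) — the `e^{−i ad_λ}` of (1.88)/(1.93).
* §2 **`gAd_eq_gSer_ad`** (`gAd X Y = g(ad_{iY})X` as the tree's operator series `gSer ℂ (ad ℂ (I•Y)) X`, `|Y| ≤ 1/12` — from
  `B7Eq32ExpDifferential.G40_eq` + `exp_ad_mul_gSer_ad`), `gSer_ad_apply_eq_fderiv` (`= e^{−Z}·D exp_Z(X)`), `norm_gSer_ad_apply_le`,
  `differentiable_gSer_ad_apply`, **`norm_gSer_ad_sub_le`** / **`norm_gAd_sub_gAd_le`** (`‖g(i ad_{Y₁})X − g(i ad_{Y₂})X‖ ≤ 10‖X‖‖Y₁ − Y₂‖`,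
  `‖Yᵢ‖ ≤ 1/12`), **`norm_gAd_sub_self_le_mul`** (`‖g(i ad_Y)X − X‖ ≤ 10‖Y‖‖X‖` — print's «|V| ≤ O(α₄)»).
* §3 `differentiableOn_W182_snd/_fst` (the exponent (1.82) is analytic in each variable on the printed region), `F183_eq_sub` (`F183 = W182 −
  g(i ad)` there, `eq182_alg`), **`norm_F183_sub_F183_snd_le`** (`‖F183 X Y₁ − F183 X Y₂‖ ≤ 984‖X‖²‖Y₁ − Y₂‖`, second order in `X`),
  **`norm_F183_sub_F183_fst_le`** (`‖F183 X₁ Y − F183 X₂ Y‖ ≤ 219ρ₀‖X₁ − X₂‖` for `‖Xᵢ‖ ≤ ρ₀`, `4ρ₀ < 1/3` — the quadratic Cauchy trick),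
  **`norm_frakF1_sub_le`** (`‖𝔉₁(l₁,D₁) − 𝔉₁(l₂,D₂)‖ ≤ 219m|D₁ − D₂| + 984m²|l₁ − l₂|`, `|Dᵢ| ≤ m`; the `η`'s cancel exactly).
* §4 `differentiableOn_F185_*`, **`norm_F185_sub_F185_snd_le`** (Lipschitz in `X`: `≤ 28‖a‖‖X₁ − X₂‖`), **`norm_F185l_sub_le`** (Lipschitz
  in the gauge parameter `l` of `l ↦ F185 (η·e^{−il}A_be^{il}) (ηD) l`: `≤ 404η²‖A_b‖‖D‖‖l₁ − l₂‖`), **`norm_frakF2_sub_le`**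
  (`‖𝔉₂(l₁,D₁,A_b) − 𝔉₂(l₂,D₂,A_b)‖ ≤ 34‖A_b‖‖D₁ − D₂‖ + 404‖A_b‖m‖l₁ − l₂‖`).

READINGS / HONEST SCOPE.  (i) Constants are ours and merely sufficient (print: «O(α₄)», «O(1)»); the windows (`‖Y‖ ≤ 1/24`, `η‖D‖ ≤ 1/140`,
…) are those of the tree's (1.82)–(1.89) lemmas halved where a Cauchy circle must fit inside them.  (ii) Nothing of Proposition 5 itself is
proved here; the assembly is the sibling.  (iii) `gAd_eq_gSer_ad` identifies p05's `gAd` with the operator series of [3] (33) BY NAME — no new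
function is introduced.  Count-neutral; N05 NOT discharged; nothing continuum / ℝ⁴ / OS / mass-gap / Clay.  Unit `pub-ymgap-dag-n19-b` (g2),
2026-08-26.  Tree API by name only, nothing restated.
-/

noncomputable section

open NormedSpace Metric Set
open Complex (I I_ne_zero)

namespace Literature.MathematicalPhysics.QuantumFieldTheory.Balaban1983to89.B8Prop5LocalLipschitz

open Literature.Analysis.Calculus.ExpDifferential (ad ad_smul ad_neg gSer gSer_zero norm_ad_le norm_gSer_sub_one_le exp_ad_apply
  exp_ad_mul_gSer_ad exp_neg_mul_fderiv_exp_apply)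
open MatrixLog (mlog analyticAt_mlog)
open B7Prop1Explicit (expUnit val_expUnit)
open B7Eq78Linearization (conjR conjR_apply)
open B7Eq38Remainder (norm_exp_mul_exp_sub_one_le G40 norm_I_smul')
open B7Eq32ExpDifferential (G40_eq)
open B8Eq182Proof (W182 gAd F183 F185 frakF1 frakF2 eq182_alg norm_F183_le norm_F185_le norm_W182_le exp_I_W182)
open B8SectDSource (lipschitz_of_norm_le)

variable {𝔸 : Type*} [NormedRing 𝔸] [NormOneClass 𝔸] [NormedAlgebra ℂ 𝔸] [CompleteSpace 𝔸]

/-! ## §1 Numerics and the conjugation `Y ↦ e^{−Z}Ye^{Z}` (the `e^{−i ad_λ}` of (1.88)) -/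

section Conj

/-- **`‖e^{−Z}Ye^{Z}‖ ≤ e^{2‖Z‖}‖Y‖`** (the conjugation `R(u′(x)⁻¹) = e^{−i ad_{λ(x)}}` of (1.88) is bounded).
[cite: Balaban1985RegularSpaces, (1.88) p.91; Balaban1985Averaging, (27) p.22] -/
theorem norm_conjExp_le (Z Y : 𝔸) : ‖exp (-Z) * Y * exp Z‖ ≤ Real.exp (2 * ‖Z‖) * ‖Y‖ := by
  have h1 := Literature.MathematicalPhysics.QuantumLattice.norm_exp_le ℂ (-Z)
  have h2 := Literature.MathematicalPhysics.QuantumLattice.norm_exp_le ℂ Z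
  rw [norm_neg] at h1
  calc ‖exp (-Z) * Y * exp Z‖ ≤ ‖exp (-Z)‖ * ‖Y‖ * ‖exp Z‖ := norm_mul₃_le
    _ ≤ Real.exp ‖Z‖ * ‖Y‖ * Real.exp ‖Z‖ := by gcongr
    _ = Real.exp (2 * ‖Z‖) * ‖Y‖ := by rw [two_mul, Real.exp_add]; ring

omit [NormOneClass 𝔸] in
/-- `Z ↦ e^{−Z}Ye^{Z}` is an entire function of the algebra-valued variable `Z` (p. 93: «𝔉 is obviously an analytic function in λ»).
[cite: Balaban1985RegularSpaces, p.93 (after (1.102))] -/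
theorem differentiable_conjExp (Y : 𝔸) : Differentiable ℂ fun Z : 𝔸 => exp (-Z) * Y * exp Z := by
  have hexp : Differentiable ℂ fun Z : 𝔸 => exp Z := fun Z => (NormedSpace.exp_analytic Z).differentiableAt
  exact ((hexp.comp differentiable_id.neg).mul_const Y).mul hexp

/-- **LIPSCHITZ IN THE GAUGE PARAMETER of the conjugation**: `‖e^{−Z₁}Ye^{Z₁} − e^{−Z₂}Ye^{Z₂}‖ ≤ 18‖Z₁ − Z₂‖‖Y‖` for `‖Zᵢ‖ ≤ ½` — by the
Cauchy formula (the device of (1.104)–(1.106)): the entire function `Z ↦ e^{−Z}Ye^{Z}` is bounded by `e²‖Y‖ ≤ 9‖Y‖` on the unit ball, hence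
`9‖Y‖/(1 − ½)`-Lipschitz on the ball of radius `½` (`B8SectDSource.lipschitz_of_norm_le`). [cite: Balaban1985RegularSpaces, (1.104)–(1.106) p.94] -/
theorem norm_conjExp_sub_conjExp_le {Z₁ Z₂ : 𝔸} (h₁ : ‖Z₁‖ ≤ 1 / 2) (h₂ : ‖Z₂‖ ≤ 1 / 2) (Y : 𝔸) :
    ‖exp (-Z₁) * Y * exp Z₁ - exp (-Z₂) * Y * exp Z₂‖ ≤ 18 * ‖Z₁ - Z₂‖ * ‖Y‖ := by
  have he : Real.exp 1 ≤ 3 := by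
    have := (abs_le.mp (Real.abs_exp_sub_one_sub_id_le (x := 1) (by norm_num))).2; linarith
  have he2 : Real.exp 2 ≤ 9 := by
    rw [show (2 : ℝ) = 1 + 1 by norm_num, Real.exp_add]; nlinarith [Real.exp_pos 1]
  have hM : ∀ Z ∈ ball (0 : 𝔸) 1, ‖exp (-Z) * Y * exp Z‖ ≤ 9 * ‖Y‖ := by
    intro Z hZ
    rw [mem_ball_zero_iff] at hZ
    refine (norm_conjExp_le Z Y).trans (mul_le_mul_of_nonneg_right ?_ (norm_nonneg Y))
    exact (Real.exp_le_exp.mpr (by linarith)).trans he2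
  have h := lipschitz_of_norm_le (differentiable_conjExp Y).differentiableOn hM (by norm_num : (1 : ℝ) / 2 < 1) h₁ h₂
  calc ‖exp (-Z₁) * Y * exp Z₁ - exp (-Z₂) * Y * exp Z₂‖ ≤ 9 * ‖Y‖ / (1 - 1 / 2) * ‖Z₁ - Z₂‖ := h
    _ = 18 * ‖Z₁ - Z₂‖ * ‖Y‖ := by ring

/-- **`‖e^{−Z}Ye^{Z} − Y‖ ≤ 18‖Z‖‖Y‖`** for `‖Z‖ ≤ ½` (the `e^{−i ad_λ} − 1` part of 𝔉₄: size `O(|λ|)`).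
[cite: Balaban1985RegularSpaces, (1.93)–(1.99) pp.92–93] -/
theorem norm_conjExp_sub_self_le {Z : 𝔸} (hZ : ‖Z‖ ≤ 1 / 2) (Y : 𝔸) : ‖exp (-Z) * Y * exp Z - Y‖ ≤ 18 * ‖Z‖ * ‖Y‖ := by
  have h := norm_conjExp_sub_conjExp_le hZ (Z₂ := 0) (by simp) Y
  simpa using h

omit [NormOneClass 𝔸] in
/-- DICTIONARY: the tree's conjugation `R((e^{Z})⁻¹)Y` (`B7Eq78Linearization.conjR`, `B7Prop1Explicit.expUnit`) IS `e^{−Z}Ye^{Z}`.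
[cite: Balaban1985RegularSpaces, (1.88) p.91] -/
theorem conjR_expUnit_inv_eq (Z Y : 𝔸) : conjR (expUnit Z)⁻¹ Y = exp (-Z) * Y * exp Z := by
  rw [conjR_apply, inv_inv, val_expUnit]; rfl

omit [NormOneClass 𝔸] in
/-- DICTIONARY: `R(e^{−Z})Y = e^{−Z}Ye^{Z}` as well (`expUnit (−Z)` has inverse `e^{Z}`).
[cite: Balaban1985RegularSpaces, (1.82) p.90] -/
theorem conjR_expUnit_neg_eq (Z Y : 𝔸) : conjR (expUnit (-Z)) Y = exp (-Z) * Y * exp Z := by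
  rw [conjR_apply, val_expUnit]
  congr 1
  change exp (-(-Z)) = exp Z
  rw [neg_neg]

end Conj

/-! ## §2 `g(i ad_Y)`: size `|V| ≤ O(|Y|)` and the Lipschitz modulus in `Y` -/

section GAd

omit [NormOneClass 𝔸] in
/-- **`gAd X Y = g(ad_{iY})X`** as the tree's operator series: for `‖Y‖ ≤ 1/12`, p05's `gAd X Y = R(e^{−iY})(G40 X Y)` equals
`gSer ℂ (ad ℂ (I•Y)) X` ([3] (33); `G40 X Y = g(−i ad_Y)X` by `B7Eq32ExpDifferential.G40_eq`, and `e^{ad W}g(ad W) = g(ad(−W))`).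
[cite: Balaban1985RegularSpaces, (1.82), (1.84) p.90; Balaban1985Averaging, (33) p.22] -/
theorem gAd_eq_gSer_ad (X : 𝔸) {Y : 𝔸} (hY : ‖Y‖ ≤ 1 / 12) : gAd X Y = gSer ℂ (ad ℂ (I • Y)) X := by
  have h1 : G40 X Y = gSer ℂ (ad ℂ (-(I • Y))) X := by
    rw [G40_eq X hY, ad_neg, ad_smul]
  have h2 : conjR (expUnit (-(I • Y))) (G40 X Y) = exp (ad ℂ (-(I • Y))) (G40 X Y) := by
    rw [exp_ad_apply, neg_neg, conjR_expUnit_neg_eq]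
  rw [gAd, h2, h1, show exp (ad ℂ (-(I • Y))) (gSer ℂ (ad ℂ (-(I • Y))) X) = (exp (ad ℂ (-(I • Y))) * gSer ℂ (ad ℂ (-(I • Y)))) X
    from rfl, exp_ad_mul_gSer_ad, neg_neg]

omit [NormOneClass 𝔸] in
/-- `g(ad_Z)X = e^{−Z}·(D exp)_Z(X)` — the trivialised differential of `exp` (tree). [cite: Balaban1985Averaging, (32) p.22] -/
theorem gSer_ad_apply_eq_fderiv (Z X : 𝔸) : gSer ℂ (ad ℂ Z) X = exp (-Z) * fderiv ℂ exp Z X :=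
  (exp_neg_mul_fderiv_exp_apply Z X).symm

omit [NormOneClass 𝔸] in
/-- **`‖g(ad_Z)X‖ ≤ (1 + (e^{2‖Z‖} − 1)/2)‖X‖`** ([3] (34) `‖g(T) − 1‖ ≤ (e^{‖T‖} − 1)/2` with `‖ad_Z‖ ≤ 2‖Z‖`); in particular `≤ 5‖X‖` on
`‖Z‖ ≤ 1`. [cite: Balaban1985Averaging, (34) p.23] -/
theorem norm_gSer_ad_apply_le (Z X : 𝔸) : ‖gSer ℂ (ad ℂ Z) X‖ ≤ (1 + (Real.exp (2 * ‖Z‖) - 1) / 2) * ‖X‖ := by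
  set T := ad ℂ Z with hT
  have hT2 : ‖T‖ ≤ 2 * ‖Z‖ := norm_ad_le Z
  have hg : ‖gSer ℂ T - 1‖ ≤ (Real.exp (2 * ‖Z‖) - 1) / 2 :=
    (norm_gSer_sub_one_le (𝕂 := ℂ) T).trans (by gcongr)
  have hdecomp : gSer ℂ T X = (gSer ℂ T - 1) X + X := by simp
  rw [hdecomp]
  calc ‖(gSer ℂ T - 1) X + X‖ ≤ ‖(gSer ℂ T - 1) X‖ + ‖X‖ := norm_add_le _ _
    _ ≤ (Real.exp (2 * ‖Z‖) - 1) / 2 * ‖X‖ + ‖X‖ :=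
        add_le_add (((gSer ℂ T - 1).le_opNorm X).trans (mul_le_mul_of_nonneg_right hg (norm_nonneg X))) le_rfl
    _ = (1 + (Real.exp (2 * ‖Z‖) - 1) / 2) * ‖X‖ := by ring

omit [NormOneClass 𝔸] in
/-- `‖g(ad_Z)X‖ ≤ 5‖X‖` on the unit ball `‖Z‖ ≤ 1`. [cite: Balaban1985Averaging, (34) p.23] -/
theorem norm_gSer_ad_apply_le_five {Z : 𝔸} (hZ : ‖Z‖ ≤ 1) (X : 𝔸) : ‖gSer ℂ (ad ℂ Z) X‖ ≤ 5 * ‖X‖ := by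
  have he : Real.exp 1 ≤ 3 := by
    have := (abs_le.mp (Real.abs_exp_sub_one_sub_id_le (x := 1) (by norm_num))).2; linarith
  have he2 : Real.exp (2 * ‖Z‖) ≤ 9 := by
    calc Real.exp (2 * ‖Z‖) ≤ Real.exp (1 + 1) := Real.exp_le_exp.mpr (by linarith)
      _ ≤ 9 := by rw [Real.exp_add]; nlinarith [Real.exp_pos 1]
  refine (norm_gSer_ad_apply_le Z X).trans (mul_le_mul_of_nonneg_right (by linarith) (norm_nonneg X))

omit [NormOneClass 𝔸] in
/-- `Z ↦ g(ad_Z)X` is entire (it is `e^{−Z}·(D exp)_Z(X)` and `exp` is analytic). [cite: Balaban1985RegularSpaces, p.93 (after (1.102))] -/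
theorem differentiable_gSer_ad_apply (X : 𝔸) : Differentiable ℂ fun Z : 𝔸 => gSer ℂ (ad ℂ Z) X := by
  have hfun : (fun Z : 𝔸 => gSer ℂ (ad ℂ Z) X) = fun Z : 𝔸 => exp (-Z) * fderiv ℂ exp Z X := by
    funext Z; exact gSer_ad_apply_eq_fderiv Z X
  rw [hfun]
  have hexp : Differentiable ℂ fun Z : 𝔸 => exp Z := fun Z => (NormedSpace.exp_analytic Z).differentiableAt
  have hfd : Differentiable ℂ fun Z : 𝔸 => fderiv ℂ exp Z := fun Z => (NormedSpace.exp_analytic Z).fderiv.differentiableAt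
  exact (hexp.comp differentiable_id.neg).mul (hfd.clm_apply (differentiable_const X))

omit [NormOneClass 𝔸] in
/-- **LIPSCHITZ IN `Y` of `g(ad_Z)X`**: `‖g(ad_{Z₁})X − g(ad_{Z₂})X‖ ≤ 10‖X‖‖Z₁ − Z₂‖` for `‖Zᵢ‖ ≤ ½` (Cauchy: bound `5‖X‖` on the unit
ball, radius `½`). [cite: Balaban1985RegularSpaces, (1.104)–(1.106) p.94; Balaban1985Averaging, (34) p.23] -/
theorem norm_gSer_ad_sub_le {Z₁ Z₂ : 𝔸} (h₁ : ‖Z₁‖ ≤ 1 / 2) (h₂ : ‖Z₂‖ ≤ 1 / 2) (X : 𝔸) :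
    ‖gSer ℂ (ad ℂ Z₁) X - gSer ℂ (ad ℂ Z₂) X‖ ≤ 10 * ‖X‖ * ‖Z₁ - Z₂‖ := by
  have hM : ∀ Z ∈ ball (0 : 𝔸) 1, ‖gSer ℂ (ad ℂ Z) X‖ ≤ 5 * ‖X‖ := fun Z hZ =>
    norm_gSer_ad_apply_le_five (mem_ball_zero_iff.mp hZ).le X
  have h := lipschitz_of_norm_le (differentiable_gSer_ad_apply X).differentiableOn hM (by norm_num : (1 : ℝ) / 2 < 1) h₁ h₂
  calc ‖gSer ℂ (ad ℂ Z₁) X - gSer ℂ (ad ℂ Z₂) X‖ ≤ 5 * ‖X‖ / (1 - 1 / 2) * ‖Z₁ - Z₂‖ := h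
    _ = 10 * ‖X‖ * ‖Z₁ - Z₂‖ := by ring

omit [NormOneClass 𝔸] in
/-- `‖g(ad_Z)X − X‖ ≤ 10‖X‖‖Z‖` for `‖Z‖ ≤ ½` (`g(ad_0) = g(0) = 1`). [cite: Balaban1985Averaging, (34) p.23] -/
theorem norm_gSer_ad_sub_self_le {Z : 𝔸} (hZ : ‖Z‖ ≤ 1 / 2) (X : 𝔸) : ‖gSer ℂ (ad ℂ Z) X - X‖ ≤ 10 * ‖X‖ * ‖Z‖ := by
  have h := norm_gSer_ad_sub_le hZ (by simp : ‖(0 : 𝔸)‖ ≤ 1 / 2) X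
  have h0 : gSer ℂ (ad ℂ (0 : 𝔸)) X = X := by
    rw [show ad ℂ (0 : 𝔸) = 0 by ext h; simp, gSer_zero]; rfl
  rwa [h0, sub_zero] at h

omit [NormOneClass 𝔸] in
/-- **print's «|V| ≤ O(α₄)»**: `‖g(i ad_Y)X − X‖ ≤ 10‖Y‖‖X‖` for `‖Y‖ ≤ 1/12` — the sitewise operator `V(x) = g(i ad_{λ(x)}) − 1` of (1.94)/(1.98)
has norm `O(|λ(x)|)`. [cite: Balaban1985RegularSpaces, (1.98) p.92, p.92 («|V| ≤ O(α₄)»)] -/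
theorem norm_gAd_sub_self_le_mul (X : 𝔸) {Y : 𝔸} (hY : ‖Y‖ ≤ 1 / 12) : ‖gAd X Y - X‖ ≤ 10 * ‖Y‖ * ‖X‖ := by
  rw [gAd_eq_gSer_ad X hY]
  have hZ : ‖(I • Y : 𝔸)‖ ≤ 1 / 2 := by rw [norm_I_smul']; linarith
  have h := norm_gSer_ad_sub_self_le hZ X
  rw [norm_I_smul'] at h
  linarith

omit [NormOneClass 𝔸] in
/-- **LIPSCHITZ IN THE GAUGE PARAMETER of `g(i ad)`**: `‖g(i ad_{Y₁})X − g(i ad_{Y₂})X‖ ≤ 10‖X‖‖Y₁ − Y₂‖` for `‖Yᵢ‖ ≤ 1/12` (the `V(λ₁) − V(λ₂)`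
piece of (1.104)–(1.106)). [cite: Balaban1985RegularSpaces, (1.104)–(1.106) p.94] -/
theorem norm_gAd_sub_gAd_le (X : 𝔸) {Y₁ Y₂ : 𝔸} (h₁ : ‖Y₁‖ ≤ 1 / 12) (h₂ : ‖Y₂‖ ≤ 1 / 12) :
    ‖gAd X Y₁ - gAd X Y₂‖ ≤ 10 * ‖X‖ * ‖Y₁ - Y₂‖ := by
  rw [gAd_eq_gSer_ad X h₁, gAd_eq_gSer_ad X h₂]
  have hZ₁ : ‖(I • Y₁ : 𝔸)‖ ≤ 1 / 2 := by rw [norm_I_smul']; linarith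
  have hZ₂ : ‖(I • Y₂ : 𝔸)‖ ≤ 1 / 2 := by rw [norm_I_smul']; linarith
  have h := norm_gSer_ad_sub_le hZ₁ hZ₂ X
  rwa [← smul_sub, norm_I_smul'] at h

omit [NormOneClass 𝔸] in
/-- `‖gAd X Y‖ ≤ 2‖X‖` for ALL `X` and `‖Y‖ ≤ 1/12` (the tree's `norm_gAd_le` needs `‖X‖ < 1/3`; here from the operator series).
[cite: Balaban1985RegularSpaces, (1.82) p.90; Balaban1985Averaging, (34) p.23] -/
theorem norm_gAd_le' (X : 𝔸) {Y : 𝔸} (hY : ‖Y‖ ≤ 1 / 12) : ‖gAd X Y‖ ≤ 2 * ‖X‖ := by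
  have h := norm_gAd_sub_self_le_mul X hY
  calc ‖gAd X Y‖ = ‖(gAd X Y - X) + X‖ := by rw [sub_add_cancel]
    _ ≤ ‖gAd X Y - X‖ + ‖X‖ := norm_add_le _ _
    _ ≤ 10 * ‖Y‖ * ‖X‖ + ‖X‖ := by linarith
    _ ≤ 2 * ‖X‖ := by nlinarith [norm_nonneg X]

end GAd

/-! ## §3 The exponent (1.82) and its remainder `F183 = O(|X|²)`: analyticity on the printed region and the Lipschitz moduli of `𝔉₁` -/

section F183

omit [NormOneClass 𝔸] in
/-- Radius bookkeeping for the logarithm in (1.82): `‖e^{−iY}e^{iY+iX} − 1‖ < 1` whenever `‖X‖ < 1/3`, `‖Y‖ < 1/8`.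
[cite: Balaban1985RegularSpaces, (1.82) p.90] -/
theorem norm_arg182_sub_one_lt {X Y : 𝔸} (hX : ‖X‖ < 1 / 3) (hY : ‖Y‖ < 1 / 8) :
    ‖exp (-(I • Y)) * exp (I • Y + I • X) - 1‖ < 1 := by
  have h1 := norm_exp_mul_exp_sub_one_le (-(I • Y)) (I • Y + I • X)
  have h2 : ‖(-(I • Y) : 𝔸)‖ + ‖I • Y + I • X‖ ≤ 2 * ‖Y‖ + ‖X‖ := by
    rw [norm_neg, norm_I_smul']
    have := norm_add_le (I • Y : 𝔸) (I • X)
    rw [norm_I_smul', norm_I_smul'] at this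
    linarith
  have h3 : Real.exp (2 * ‖Y‖ + ‖X‖) ≤ 1 + (2 * ‖Y‖ + ‖X‖) + (2 * ‖Y‖ + ‖X‖) ^ 2 := by
    have := (abs_le.mp (Real.abs_exp_sub_one_sub_id_le (x := 2 * ‖Y‖ + ‖X‖)
      (abs_le.mpr ⟨by nlinarith [norm_nonneg X, norm_nonneg Y], by nlinarith⟩))).2
    linarith
  have h4 : 2 * ‖Y‖ + ‖X‖ < 7 / 12 := by linarith
  have h5 : (2 * ‖Y‖ + ‖X‖) + (2 * ‖Y‖ + ‖X‖) ^ 2 < 1 := by nlinarith [norm_nonneg X, norm_nonneg Y]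
  calc ‖exp (-(I • Y)) * exp (I • Y + I • X) - 1‖ ≤ Real.exp (‖(-(I • Y) : 𝔸)‖ + ‖I • Y + I • X‖) - 1 := h1
    _ ≤ Real.exp (2 * ‖Y‖ + ‖X‖) - 1 := by gcongr
    _ < 1 := by linarith

omit [NormOneClass 𝔸] in
/-- The exponent (1.82) `W182 X Y = (1/i) log(e^{−iY}e^{iY+iX})` is complex-differentiable in `Y` on `‖Y‖ < 1/8` (for `‖X‖ < 1/3`).
[cite: Balaban1985RegularSpaces, (1.82) p.90, p.93 («analytic function in λ»)] -/
theorem differentiableAt_W182_snd {X Y : 𝔸} (hX : ‖X‖ < 1 / 3) (hY : ‖Y‖ < 1 / 8) :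
    DifferentiableAt ℂ (fun Y : 𝔸 => W182 X Y) Y := by
  have hexp : Differentiable ℂ fun Z : 𝔸 => exp Z := fun Z => (NormedSpace.exp_analytic Z).differentiableAt
  have hsm : Differentiable ℂ fun Y : 𝔸 => (I • Y : 𝔸) := differentiable_id.const_smul I
  have hin : DifferentiableAt ℂ (fun Y : 𝔸 => exp (-(I • Y)) * exp (I • Y + I • X)) Y :=
    ((hexp.comp hsm.neg).mul (hexp.comp (hsm.add_const _))) Y
  have hlog : DifferentiableAt ℂ (mlog : 𝔸 → 𝔸) (exp (-(I • Y)) * exp (I • Y + I • X)) :=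
    (analyticAt_mlog (norm_arg182_sub_one_lt hX hY)).differentiableAt
  unfold W182
  exact (hlog.comp Y hin).const_smul (I⁻¹ : ℂ)

omit [NormOneClass 𝔸] in
/-- The exponent (1.82) is complex-differentiable in `X` on `‖X‖ < 1/3` (for `‖Y‖ < 1/8`). [cite: Balaban1985RegularSpaces, (1.82) p.90] -/
theorem differentiableAt_W182_fst {X Y : 𝔸} (hX : ‖X‖ < 1 / 3) (hY : ‖Y‖ < 1 / 8) :
    DifferentiableAt ℂ (fun X : 𝔸 => W182 X Y) X := by
  have hexp : Differentiable ℂ fun Z : 𝔸 => exp Z := fun Z => (NormedSpace.exp_analytic Z).differentiableAt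
  have hsm : Differentiable ℂ fun X : 𝔸 => (I • X : 𝔸) := differentiable_id.const_smul I
  have hin : DifferentiableAt ℂ (fun X : 𝔸 => exp (-(I • Y)) * exp (I • Y + I • X)) X :=
    ((differentiableAt_const _).mul ((hexp.comp (hsm.const_add _)) X))
  have hlog : DifferentiableAt ℂ (mlog : 𝔸 → 𝔸) (exp (-(I • Y)) * exp (I • Y + I • X)) :=
    (analyticAt_mlog (norm_arg182_sub_one_lt hX hY)).differentiableAt
  unfold W182
  exact (hlog.comp X hin).const_smul (I⁻¹ : ℂ)

omit [NormOneClass 𝔸] in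
/-- On the printed region `F183 X Y = W182 X Y − g(i ad_Y)X` with `g(i ad_Y)X` the operator series (`eq182_alg` + `gAd_eq_gSer_ad`).
[cite: Balaban1985RegularSpaces, (1.82)–(1.83) p.90] -/
theorem F183_eq_sub {X Y : 𝔸} (hX : ‖X‖ < 1 / 3) (hY : ‖Y‖ ≤ 1 / 12) : F183 X Y = W182 X Y - gSer ℂ (ad ℂ (I • Y)) X := by
  rw [← gAd_eq_gSer_ad X hY, eq182_alg hX hY, add_sub_cancel_left]

/-- **LIPSCHITZ IN `Y` of `F183`, SECOND ORDER IN `X`**: `‖F183 X Y₁ − F183 X Y₂‖ ≤ 984‖X‖²‖Y₁ − Y₂‖` for `‖X‖ < 1/3`, `‖Yᵢ‖ ≤ 1/24` — Cauchy on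
the `Y`-ball of radius `1/12` where `|F183| ≤ 41|X|²` (`norm_F183_le`). [cite: Balaban1985RegularSpaces, (1.83) p.90, (1.104)–(1.106) p.94] -/
theorem norm_F183_sub_F183_snd_le {X Y₁ Y₂ : 𝔸} (hX : ‖X‖ < 1 / 3) (h₁ : ‖Y₁‖ ≤ 1 / 24) (h₂ : ‖Y₂‖ ≤ 1 / 24) :
    ‖F183 X Y₁ - F183 X Y₂‖ ≤ 984 * ‖X‖ ^ 2 * ‖Y₁ - Y₂‖ := by
  set Φ : 𝔸 → 𝔸 := fun Y => W182 X Y - gSer ℂ (ad ℂ (I • Y)) X with hΦ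
  have hd : DifferentiableOn ℂ Φ (ball (0 : 𝔸) (1 / 12)) := by
    intro Y hY
    have hY' : ‖Y‖ < 1 / 8 := by have := mem_ball_zero_iff.mp hY; linarith
    refine DifferentiableAt.differentiableWithinAt ?_
    have hsm : Differentiable ℂ fun Y : 𝔸 => (I • Y : 𝔸) := differentiable_id.const_smul I
    exact (differentiableAt_W182_snd hX hY').sub (((differentiable_gSer_ad_apply X).comp hsm) Y)
  have hM : ∀ Y ∈ ball (0 : 𝔸) (1 / 12), ‖Φ Y‖ ≤ 41 * ‖X‖ ^ 2 := by
    intro Y hY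
    have hY' : ‖Y‖ ≤ 1 / 12 := (mem_ball_zero_iff.mp hY).le
    rw [hΦ]; dsimp only
    rw [← F183_eq_sub hX hY']
    exact norm_F183_le hX hY'
  have h := lipschitz_of_norm_le hd hM (by norm_num : (1 : ℝ) / 24 < 1 / 12) h₁ h₂
  have e₁ : Φ Y₁ = F183 X Y₁ := by rw [hΦ]; exact (F183_eq_sub hX (by linarith)).symm
  have e₂ : Φ Y₂ = F183 X Y₂ := by rw [hΦ]; exact (F183_eq_sub hX (by linarith)).symm
  rw [e₁, e₂] at h
  calc ‖F183 X Y₁ - F183 X Y₂‖ ≤ 41 * ‖X‖ ^ 2 / (1 / 12 - 1 / 24) * ‖Y₁ - Y₂‖ := h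
    _ = 984 * ‖X‖ ^ 2 * ‖Y₁ - Y₂‖ := by ring

/-- **LIPSCHITZ IN `X` of `F183`, WITH A SMALL CONSTANT** (the quadratic Cauchy trick): if `‖X₁‖, ‖X₂‖ ≤ ρ₀`, `0 < ρ₀`, `4ρ₀ < 1/3` and
`‖Y‖ ≤ 1/12`, then `‖F183 X₁ Y − F183 X₂ Y‖ ≤ 219ρ₀‖X₁ − X₂‖` — Cauchy on the `X`-ball of radius `4ρ₀`, where `|F183| ≤ 41(4ρ₀)²`, read on the
ball of radius `ρ₀`: constant `656ρ₀²/(3ρ₀) ≤ 219ρ₀`. [cite: Balaban1985RegularSpaces, (1.83) p.90, (1.104)–(1.106) p.94] -/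
theorem norm_F183_sub_F183_fst_le {X₁ X₂ Y : 𝔸} {ρ₀ : ℝ} (hρ : 0 < ρ₀) (hρ4 : 4 * ρ₀ < 1 / 3) (h₁ : ‖X₁‖ ≤ ρ₀) (h₂ : ‖X₂‖ ≤ ρ₀)
    (hY : ‖Y‖ ≤ 1 / 12) : ‖F183 X₁ Y - F183 X₂ Y‖ ≤ 219 * ρ₀ * ‖X₁ - X₂‖ := by
  set Φ : 𝔸 → 𝔸 := fun X => W182 X Y - gSer ℂ (ad ℂ (I • Y)) X with hΦ
  have hY' : ‖Y‖ < 1 / 8 := by linarith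
  have hd : DifferentiableOn ℂ Φ (ball (0 : 𝔸) (4 * ρ₀)) := by
    intro X hX
    have hX' : ‖X‖ < 1 / 3 := by have := mem_ball_zero_iff.mp hX; linarith
    refine DifferentiableAt.differentiableWithinAt ?_
    exact (differentiableAt_W182_fst hX' hY').sub ((gSer ℂ (ad ℂ (I • Y))).differentiableAt)
  have hM : ∀ X ∈ ball (0 : 𝔸) (4 * ρ₀), ‖Φ X‖ ≤ 656 * ρ₀ ^ 2 := by
    intro X hX
    have hXn := mem_ball_zero_iff.mp hX
    have hX' : ‖X‖ < 1 / 3 := by linarith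
    rw [hΦ]; dsimp only
    rw [← F183_eq_sub hX' hY]
    calc ‖F183 X Y‖ ≤ 41 * ‖X‖ ^ 2 := norm_F183_le hX' hY
      _ ≤ 41 * (4 * ρ₀) ^ 2 := by gcongr
      _ = 656 * ρ₀ ^ 2 := by ring
  have h := lipschitz_of_norm_le hd hM (by linarith : ρ₀ < 4 * ρ₀) h₁ h₂
  have e₁ : Φ X₁ = F183 X₁ Y := by rw [hΦ]; exact (F183_eq_sub (by linarith) hY).symm
  have e₂ : Φ X₂ = F183 X₂ Y := by rw [hΦ]; exact (F183_eq_sub (by linarith) hY).symm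
  rw [e₁, e₂] at h
  have hc : 656 * ρ₀ ^ 2 / (4 * ρ₀ - ρ₀) ≤ 219 * ρ₀ := by
    rw [div_le_iff₀ (by linarith)]; nlinarith
  exact h.trans (mul_le_mul_of_nonneg_right hc (norm_nonneg _))

/-- **THE LIPSCHITZ MODULUS OF `𝔉₁` OF (1.82)–(1.83)** in its printed arguments `l = λ(b₋)`, `D = (Dλ)(b)`: for `η > 0`, `‖lᵢ‖ ≤ 1/24`,
`‖Dᵢ‖ ≤ m`, `0 < m`, `4ηm < 1/3`: `‖𝔉₁(l₁, D₁) − 𝔉₁(l₂, D₂)‖ ≤ 219m‖D₁ − D₂‖ + 984m²‖l₁ − l₂‖` (the two `η⁻²`'s of `𝔉₁ = η⁻²F183(ηD, l)`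
cancel against the homogeneity of the two Cauchy constants — second order preserved, as (1.106) needs).
[cite: Balaban1985RegularSpaces, (1.83) p.90, (1.104)–(1.106) p.94] -/
theorem norm_frakF1_sub_le {η : ℝ} (hη : 0 < η) {l₁ l₂ D₁ D₂ : 𝔸} {m : ℝ} (hm : 0 < m) (hm4 : 4 * (η * m) < 1 / 3)
    (hl₁ : ‖l₁‖ ≤ 1 / 24) (hl₂ : ‖l₂‖ ≤ 1 / 24) (hD₁ : ‖D₁‖ ≤ m) (hD₂ : ‖D₂‖ ≤ m) :
    ‖frakF1 η l₁ D₁ - frakF1 η l₂ D₂‖ ≤ 219 * m * ‖D₁ - D₂‖ + 984 * m ^ 2 * ‖l₁ - l₂‖ := by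
  have hη2 : 0 < η ^ 2 := pow_pos hη 2
  have hX₁ : ‖(η • D₁ : 𝔸)‖ ≤ η * m := by rw [norm_smul, Real.norm_of_nonneg hη.le]; gcongr
  have hX₂ : ‖(η • D₂ : 𝔸)‖ ≤ η * m := by rw [norm_smul, Real.norm_of_nonneg hη.le]; gcongr
  have hX₂' : ‖(η • D₂ : 𝔸)‖ < 1 / 3 := by linarith
  -- split: F183(ηD₁, l₁) − F183(ηD₂, l₂) = [F183(ηD₁, l₁) − F183(ηD₂, l₁)] + [F183(ηD₂, l₁) − F183(ηD₂, l₂)]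
  have hA := norm_F183_sub_F183_fst_le (Y := l₁) (by positivity : 0 < η * m) hm4 hX₁ hX₂ (by linarith)
  have hB := norm_F183_sub_F183_snd_le hX₂' hl₁ hl₂
  have hsplit : frakF1 η l₁ D₁ - frakF1 η l₂ D₂ =
      (η ^ 2)⁻¹ • ((F183 (η • D₁) l₁ - F183 (η • D₂) l₁) + (F183 (η • D₂) l₁ - F183 (η • D₂) l₂)) := by
    simp only [frakF1, ← smul_sub]; congr 1; abel
  rw [hsplit, norm_smul, norm_inv, Real.norm_of_nonneg hη2.le]
  have hXdiff : ‖(η • D₁ : 𝔸) - η • D₂‖ = η * ‖D₁ - D₂‖ := by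
    rw [← smul_sub, norm_smul, Real.norm_of_nonneg hη.le]
  rw [hXdiff] at hA
  have hX₂sq : ‖(η • D₂ : 𝔸)‖ ^ 2 ≤ (η * m) ^ 2 := by gcongr
  have hB' : ‖F183 (η • D₂) l₁ - F183 (η • D₂) l₂‖ ≤ 984 * (η * m) ^ 2 * ‖l₁ - l₂‖ :=
    hB.trans (by gcongr)
  have hsum : ‖(F183 (η • D₁) l₁ - F183 (η • D₂) l₁) + (F183 (η • D₂) l₁ - F183 (η • D₂) l₂)‖ ≤
      219 * (η * m) * (η * ‖D₁ - D₂‖) + 984 * (η * m) ^ 2 * ‖l₁ - l₂‖ :=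
    (norm_add_le _ _).trans (add_le_add hA hB')
  calc (η ^ 2)⁻¹ * ‖(F183 (η • D₁) l₁ - F183 (η • D₂) l₁) + (F183 (η • D₂) l₁ - F183 (η • D₂) l₂)‖
      ≤ (η ^ 2)⁻¹ * (219 * (η * m) * (η * ‖D₁ - D₂‖) + 984 * (η * m) ^ 2 * ‖l₁ - l₂‖) := by gcongr
    _ = 219 * m * ‖D₁ - D₂‖ + 984 * m ^ 2 * ‖l₁ - l₂‖ := by field_simp

end F183

/-! ## §4 The BCH defect `F185 = O(|a||X|)` of (1.84)–(1.85): analyticity and the Lipschitz moduli of `𝔉₂` -/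

section F185

/-- `e^{1/6} ≤ 6/5` (numerics for `‖e^{−il}A_be^{il}‖ ≤ (6/5)‖A_b‖` on `‖l‖ ≤ 1/12`). [cite: Balaban1985RegularSpaces, (1.85) p.90] -/
theorem rexp_one_sixth_le : Real.exp (2 * (1 / 12)) ≤ 6 / 5 := by
  have h := (abs_le.mp (Real.abs_exp_sub_one_sub_id_le (x := 2 * (1 / 12)) (by rw [abs_le]; constructor <;> norm_num))).2
  norm_num at h ⊢; linarith

/-- Radius bookkeeping for the outer logarithm of (1.84): for `‖a‖ < 1/10`, `‖X‖ < 1/70`, `‖Y‖ ≤ 1/12`,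
`‖e^{ia}e^{iW182 X Y} − 1‖ < 1` (`|W182| ≤ 7|X|`). [cite: Balaban1985RegularSpaces, (1.84)–(1.85) p.90] -/
theorem norm_arg185_sub_one_lt {a X Y : 𝔸} (ha : ‖a‖ < 1 / 10) (hX : ‖X‖ < 1 / 70) (hY : ‖Y‖ ≤ 1 / 12) :
    ‖exp (I • a) * exp (I • W182 X Y) - 1‖ < 1 := by
  have hW := norm_W182_le (lt_trans hX (by norm_num)) hY
  have h1 := norm_exp_mul_exp_sub_one_le (I • a) (I • W182 X Y)
  rw [norm_I_smul', norm_I_smul'] at h1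
  have hs : ‖a‖ + ‖W182 X Y‖ < 1 / 5 := by linarith
  have h3 : Real.exp (‖a‖ + ‖W182 X Y‖) ≤ 1 + (‖a‖ + ‖W182 X Y‖) + (‖a‖ + ‖W182 X Y‖) ^ 2 := by
    have := (abs_le.mp (Real.abs_exp_sub_one_sub_id_le (x := ‖a‖ + ‖W182 X Y‖)
      (abs_le.mpr ⟨by nlinarith [norm_nonneg a, norm_nonneg (W182 X Y)], by linarith⟩))).2
    linarith
  have h4 : (‖a‖ + ‖W182 X Y‖) + (‖a‖ + ‖W182 X Y‖) ^ 2 < 1 := by nlinarith [norm_nonneg a, norm_nonneg (W182 X Y)]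
  linarith

/-- `F185 a X Y` is complex-differentiable in `X` at every `‖X‖ < 1/70` (for `‖a‖ < 1/10`, `‖Y‖ < 1/12`).
[cite: Balaban1985RegularSpaces, (1.84)–(1.85) p.90, p.93 («analytic function in λ»)] -/
theorem differentiableAt_F185_snd {a X Y : 𝔸} (ha : ‖a‖ < 1 / 10) (hX : ‖X‖ < 1 / 70) (hY : ‖Y‖ < 1 / 12) :
    DifferentiableAt ℂ (fun X : 𝔸 => F185 a X Y) X := by
  have hexp : Differentiable ℂ fun Z : 𝔸 => exp Z := fun Z => (NormedSpace.exp_analytic Z).differentiableAt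
  have hW : DifferentiableAt ℂ (fun X : 𝔸 => W182 X Y) X := differentiableAt_W182_fst (by linarith) (by linarith)
  have hin : DifferentiableAt ℂ (fun X : 𝔸 => exp (I • a) * exp (I • W182 X Y)) X :=
    (differentiableAt_const _).mul ((hexp _).comp X (hW.const_smul I))
  have hlog : DifferentiableAt ℂ (mlog : 𝔸 → 𝔸) (exp (I • a) * exp (I • W182 X Y)) :=
    (analyticAt_mlog (norm_arg185_sub_one_lt ha hX hY.le)).differentiableAt
  unfold F185
  exact (((hlog.comp X hin).sub (differentiableAt_const _)).sub (hW.const_smul I)).const_smul (I⁻¹ : ℂ)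

/-- **LIPSCHITZ IN `X` of `F185`**: `‖F185 a X₁ Y − F185 a X₂ Y‖ ≤ 28‖a‖‖X₁ − X₂‖` for `‖a‖ < 1/10`, `‖Xᵢ‖ ≤ 1/140`, `‖Y‖ < 1/12` (Cauchy on the
`X`-ball of radius `1/70` where `|F185| ≤ 14|a||X| ≤ ‖a‖/5`). [cite: Balaban1985RegularSpaces, (1.85) p.90, (1.104)–(1.106) p.94] -/
theorem norm_F185_sub_F185_snd_le {a X₁ X₂ Y : 𝔸} (ha : ‖a‖ < 1 / 10) (h₁ : ‖X₁‖ ≤ 1 / 140) (h₂ : ‖X₂‖ ≤ 1 / 140)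
    (hY : ‖Y‖ < 1 / 12) : ‖F185 a X₁ Y - F185 a X₂ Y‖ ≤ 28 * ‖a‖ * ‖X₁ - X₂‖ := by
  have hd : DifferentiableOn ℂ (fun X : 𝔸 => F185 a X Y) (ball (0 : 𝔸) (1 / 70)) := fun X hX =>
    (differentiableAt_F185_snd ha (mem_ball_zero_iff.mp hX) hY).differentiableWithinAt
  have hM : ∀ X ∈ ball (0 : 𝔸) (1 / 70), ‖F185 a X Y‖ ≤ ‖a‖ / 5 := by
    intro X hX
    have hXn := (mem_ball_zero_iff.mp hX).le
    calc ‖F185 a X Y‖ ≤ 14 * ‖a‖ * ‖X‖ := norm_F185_le ha.le hXn hY.le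
      _ ≤ 14 * ‖a‖ * (1 / 70) := by gcongr
      _ = ‖a‖ / 5 := by ring
  have h := lipschitz_of_norm_le hd hM (by norm_num : (1 : ℝ) / 140 < 1 / 70) h₁ h₂
  calc ‖F185 a X₁ Y - F185 a X₂ Y‖ ≤ ‖a‖ / 5 / (1 / 70 - 1 / 140) * ‖X₁ - X₂‖ := h
    _ = 28 * ‖a‖ * ‖X₁ - X₂‖ := by ring

/-- The first argument of `𝔉₂`: `a(l) = η·e^{−il}A_be^{il}` has `‖a(l)‖ ≤ (6/5)η‖A_b‖` for `‖l‖ ≤ 1/12`.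
[cite: Balaban1985RegularSpaces, (1.84)–(1.85) p.90] -/
theorem norm_eta_conj_le {η : ℝ} (hη : 0 ≤ η) {l : 𝔸} (hl : ‖l‖ ≤ 1 / 12) (Ab : 𝔸) :
    ‖(η • conjR (expUnit (-(I • l))) Ab : 𝔸)‖ ≤ 6 / 5 * (η * ‖Ab‖) := by
  rw [norm_smul, Real.norm_of_nonneg hη, conjR_expUnit_neg_eq]
  have h := norm_conjExp_le (I • l) Ab
  rw [norm_I_smul'] at h
  have he : Real.exp (2 * ‖l‖) ≤ 6 / 5 := (Real.exp_le_exp.mpr (by linarith)).trans rexp_one_sixth_le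
  calc η * ‖exp (-(I • l)) * Ab * exp (I • l)‖ ≤ η * (Real.exp (2 * ‖l‖) * ‖Ab‖) := by gcongr
    _ ≤ η * (6 / 5 * ‖Ab‖) := by gcongr
    _ = 6 / 5 * (η * ‖Ab‖) := by ring

/-- The composite `l ↦ F185 (η·e^{−il}A_be^{il}) (ηD) l` (the `l`-dependence of `𝔉₂`) is complex-differentiable at every `‖l‖ < 1/12`, for
`η‖D‖ < 1/70`, `(6/5)η‖A_b‖·e^{…} < 1/10` (here: `η‖A_b‖ ≤ 1/13`). [cite: Balaban1985RegularSpaces, (1.84)–(1.85) p.90, p.93] -/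
theorem differentiableAt_F185l {η : ℝ} (hη : 0 < η) {l D Ab : 𝔸} (hl : ‖l‖ < 1 / 12) (hD : η * ‖D‖ < 1 / 70)
    (hA : η * ‖Ab‖ ≤ 1 / 13) :
    DifferentiableAt ℂ (fun l : 𝔸 => F185 (η • conjR (expUnit (-(I • l))) Ab) (η • D) l) l := by
  have hexp : Differentiable ℂ fun Z : 𝔸 => exp Z := fun Z => (NormedSpace.exp_analytic Z).differentiableAt
  have hX : ‖(η • D : 𝔸)‖ < 1 / 70 := by rwa [norm_smul, Real.norm_of_nonneg hη.le]
  -- the first argument as an explicit entire function of `l`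
  have harg : (fun l : 𝔸 => (η • conjR (expUnit (-(I • l))) Ab : 𝔸)) = fun l : 𝔸 => η • (exp (-(I • l)) * Ab * exp (I • l)) := by
    funext l; rw [conjR_expUnit_neg_eq]
  have ha_diff : Differentiable ℂ fun l : 𝔸 => (η • conjR (expUnit (-(I • l))) Ab : 𝔸) := by
    rw [harg]
    have hsm : Differentiable ℂ fun l : 𝔸 => (I • l : 𝔸) := differentiable_id.const_smul I
    have h1 : Differentiable ℂ fun l : 𝔸 => exp (-(I • l)) * Ab * exp (I • l) := (differentiable_conjExp Ab).comp hsm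
    exact h1.const_smul η
  have ha_lt : ‖(η • conjR (expUnit (-(I • l))) Ab : 𝔸)‖ < 1 / 10 := by
    have := norm_eta_conj_le hη.le hl.le Ab
    linarith
  have hW : DifferentiableAt ℂ (fun l : 𝔸 => W182 (η • D) l) l := differentiableAt_W182_snd (by linarith) (by linarith)
  have hin : DifferentiableAt ℂ (fun l : 𝔸 => exp (I • (η • conjR (expUnit (-(I • l))) Ab : 𝔸)) * exp (I • W182 (η • D) l)) l :=
    ((hexp _).comp l ((ha_diff l).const_smul I)).mul ((hexp _).comp l (hW.const_smul I))
  have hlog : DifferentiableAt ℂ (mlog : 𝔸 → 𝔸) (exp (I • (η • conjR (expUnit (-(I • l))) Ab : 𝔸)) * exp (I • W182 (η • D) l)) :=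
    (analyticAt_mlog (norm_arg185_sub_one_lt ha_lt hX hl.le)).differentiableAt
  unfold F185
  exact (((hlog.comp l hin).sub ((ha_diff l).const_smul I)).sub (hW.const_smul I)).const_smul (I⁻¹ : ℂ)

/-- **LIPSCHITZ IN THE GAUGE PARAMETER `l` of `l ↦ F185 (η·e^{−il}A_be^{il}) (ηD) l`**: for `η > 0`, `‖lᵢ‖ ≤ 1/24`, `η‖D‖ < 1/70`,
`η‖A_b‖ ≤ 1/13`: `‖… l₁ − … l₂‖ ≤ 404η²‖A_b‖‖D‖‖l₁ − l₂‖` (Cauchy on the `l`-ball of radius `1/12`, bound `14·(6/5)η‖A_b‖·η‖D‖`).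
[cite: Balaban1985RegularSpaces, (1.85) p.90, (1.104)–(1.106) p.94] -/
theorem norm_F185l_sub_le {η : ℝ} (hη : 0 < η) {l₁ l₂ D Ab : 𝔸} (hl₁ : ‖l₁‖ ≤ 1 / 24) (hl₂ : ‖l₂‖ ≤ 1 / 24)
    (hD : η * ‖D‖ < 1 / 70) (hA : η * ‖Ab‖ ≤ 1 / 13) :
    ‖F185 (η • conjR (expUnit (-(I • l₁))) Ab) (η • D) l₁ - F185 (η • conjR (expUnit (-(I • l₂))) Ab) (η • D) l₂‖ ≤
      404 * η ^ 2 * ‖Ab‖ * ‖D‖ * ‖l₁ - l₂‖ := by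
  set Φ : 𝔸 → 𝔸 := fun l => F185 (η • conjR (expUnit (-(I • l))) Ab) (η • D) l with hΦ
  have hd : DifferentiableOn ℂ Φ (ball (0 : 𝔸) (1 / 12)) := fun l hl =>
    (differentiableAt_F185l hη (mem_ball_zero_iff.mp hl) hD hA).differentiableWithinAt
  have hX : ‖(η • D : 𝔸)‖ ≤ 1 / 70 := by rw [norm_smul, Real.norm_of_nonneg hη.le]; exact hD.le
  have hM : ∀ l ∈ ball (0 : 𝔸) (1 / 12), ‖Φ l‖ ≤ 14 * (6 / 5 * (η * ‖Ab‖)) * (η * ‖D‖) := by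
    intro l hl
    have hln := (mem_ball_zero_iff.mp hl).le
    have ha := norm_eta_conj_le hη.le hln Ab
    have ha' : ‖(η • conjR (expUnit (-(I • l))) Ab : 𝔸)‖ ≤ 1 / 10 := by linarith
    rw [hΦ]; dsimp only
    calc ‖F185 (η • conjR (expUnit (-(I • l))) Ab) (η • D) l‖ ≤ 14 * ‖(η • conjR (expUnit (-(I • l))) Ab : 𝔸)‖ * ‖(η • D : 𝔸)‖ :=
          norm_F185_le ha' hX hln
      _ ≤ 14 * (6 / 5 * (η * ‖Ab‖)) * (η * ‖D‖) := by
          rw [show ‖(η • D : 𝔸)‖ = η * ‖D‖ by rw [norm_smul, Real.norm_of_nonneg hη.le]]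
          gcongr
  have h := lipschitz_of_norm_le hd hM (by norm_num : (1 : ℝ) / 24 < 1 / 12) hl₁ hl₂
  calc ‖Φ l₁ - Φ l₂‖ ≤ 14 * (6 / 5 * (η * ‖Ab‖)) * (η * ‖D‖) / (1 / 12 - 1 / 24) * ‖l₁ - l₂‖ := h
    _ = (2016 / 5) * η ^ 2 * ‖Ab‖ * ‖D‖ * ‖l₁ - l₂‖ := by ring
    _ ≤ 404 * η ^ 2 * ‖Ab‖ * ‖D‖ * ‖l₁ - l₂‖ := by
        have : 0 ≤ η ^ 2 * ‖Ab‖ * ‖D‖ * ‖l₁ - l₂‖ := by positivity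
        nlinarith

/-- **THE LIPSCHITZ MODULUS OF `𝔉₂` OF (1.84)–(1.85)** in its printed arguments `l = λ(b₋)`, `D = (Dλ)(b)` at fixed `A_b`: for `η > 0`,
`‖lᵢ‖ ≤ 1/24`, `‖Dᵢ‖ ≤ m` with `ηm ≤ 1/140`, `η‖A_b‖ ≤ 1/13`:
`‖𝔉₂(l₁, D₁, A_b) − 𝔉₂(l₂, D₂, A_b)‖ ≤ 34‖A_b‖‖D₁ − D₂‖ + 404‖A_b‖m‖l₁ − l₂‖` (the `η⁻²` of `𝔉₂ = η⁻²F185(…)` cancels exactly).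
[cite: Balaban1985RegularSpaces, (1.85) p.90, (1.104)–(1.106) p.94] -/
theorem norm_frakF2_sub_le {η : ℝ} (hη : 0 < η) {l₁ l₂ D₁ D₂ Ab : 𝔸} {m : ℝ} (hmη : η * m ≤ 1 / 140)
    (hl₁ : ‖l₁‖ ≤ 1 / 24) (hl₂ : ‖l₂‖ ≤ 1 / 24) (hD₁ : ‖D₁‖ ≤ m) (hD₂ : ‖D₂‖ ≤ m) (hA : η * ‖Ab‖ ≤ 1 / 13) :
    ‖frakF2 η l₁ D₁ Ab - frakF2 η l₂ D₂ Ab‖ ≤ 34 * ‖Ab‖ * ‖D₁ - D₂‖ + 404 * ‖Ab‖ * m * ‖l₁ - l₂‖ := by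
  have hη2 : 0 < η ^ 2 := pow_pos hη 2
  have hX₁ : ‖(η • D₁ : 𝔸)‖ ≤ 1 / 140 := by
    rw [norm_smul, Real.norm_of_nonneg hη.le]; exact (mul_le_mul_of_nonneg_left hD₁ hη.le).trans hmη
  have hX₂ : ‖(η • D₂ : 𝔸)‖ ≤ 1 / 140 := by
    rw [norm_smul, Real.norm_of_nonneg hη.le]; exact (mul_le_mul_of_nonneg_left hD₂ hη.le).trans hmη
  have hD₂η : η * ‖D₂‖ < 1 / 70 := by nlinarith [norm_nonneg D₂]
  set a₁ : 𝔸 := η • conjR (expUnit (-(I • l₁))) Ab with ha₁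
  have ha₁n : ‖a₁‖ ≤ 6 / 5 * (η * ‖Ab‖) := norm_eta_conj_le hη.le (by linarith) Ab
  have ha₁lt : ‖a₁‖ < 1 / 10 := by linarith
  -- split: [F185 a₁ (ηD₁) l₁ − F185 a₁ (ηD₂) l₁] + [F185 a(l₁) (ηD₂) l₁ − F185 a(l₂) (ηD₂) l₂]
  have hP := norm_F185_sub_F185_snd_le (Y := l₁) ha₁lt hX₁ hX₂ (by linarith)
  have hQ := norm_F185l_sub_le hη hl₁ hl₂ hD₂η hA
  have hsplit : frakF2 η l₁ D₁ Ab - frakF2 η l₂ D₂ Ab =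
      (η ^ 2)⁻¹ • ((F185 a₁ (η • D₁) l₁ - F185 a₁ (η • D₂) l₁) +
        (F185 (η • conjR (expUnit (-(I • l₁))) Ab) (η • D₂) l₁ - F185 (η • conjR (expUnit (-(I • l₂))) Ab) (η • D₂) l₂)) := by
    simp only [frakF2, ← smul_sub, ha₁]; congr 1; abel
  rw [hsplit, norm_smul, norm_inv, Real.norm_of_nonneg hη2.le]
  have hXdiff : ‖(η • D₁ : 𝔸) - η • D₂‖ = η * ‖D₁ - D₂‖ := by
    rw [← smul_sub, norm_smul, Real.norm_of_nonneg hη.le]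
  rw [hXdiff] at hP
  have hP' : ‖F185 a₁ (η • D₁) l₁ - F185 a₁ (η • D₂) l₁‖ ≤ 28 * (6 / 5 * (η * ‖Ab‖)) * (η * ‖D₁ - D₂‖) :=
    hP.trans (by gcongr)
  have hQ' : ‖F185 (η • conjR (expUnit (-(I • l₁))) Ab) (η • D₂) l₁ - F185 (η • conjR (expUnit (-(I • l₂))) Ab) (η • D₂) l₂‖ ≤
      404 * η ^ 2 * ‖Ab‖ * m * ‖l₁ - l₂‖ := by
    refine hQ.trans ?_
    have : 0 ≤ η ^ 2 * ‖Ab‖ * ‖l₁ - l₂‖ := by positivity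
    nlinarith
  calc (η ^ 2)⁻¹ * ‖(F185 a₁ (η • D₁) l₁ - F185 a₁ (η • D₂) l₁) +
        (F185 (η • conjR (expUnit (-(I • l₁))) Ab) (η • D₂) l₁ - F185 (η • conjR (expUnit (-(I • l₂))) Ab) (η • D₂) l₂)‖
      ≤ (η ^ 2)⁻¹ * (28 * (6 / 5 * (η * ‖Ab‖)) * (η * ‖D₁ - D₂‖) + 404 * η ^ 2 * ‖Ab‖ * m * ‖l₁ - l₂‖) := by
        gcongr
        exact (norm_add_le _ _).trans (add_le_add hP' hQ')
    _ = 168 / 5 * ‖Ab‖ * ‖D₁ - D₂‖ + 404 * ‖Ab‖ * m * ‖l₁ - l₂‖ := by field_simp; ring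
    _ ≤ 34 * ‖Ab‖ * ‖D₁ - D₂‖ + 404 * ‖Ab‖ * m * ‖l₁ - l₂‖ := by
        have : 0 ≤ ‖Ab‖ * ‖D₁ - D₂‖ := by positivity
        nlinarith

end F185

#print axioms norm_gAd_sub_gAd_le
#print axioms norm_frakF1_sub_le
#print axioms norm_frakF2_sub_le

end Literature.MathematicalPhysics.QuantumFieldTheory.Balaban1983to89.B8Prop5LocalLipschitz

end
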